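import Summits.QuantumFields.GaugeBoot.ClassBStrongCoupling
import Literature.MathematicalPhysics.QuantumFieldTheory.Balaban1983to89.StrongCouplingVarianceWindow
import HarnessLib

/-!
# Class B for four-dimensional `SU(2)` up to Wilson coupling `β_W = 0.124` (gauge-boot, L3(α))

HONEST FRAMING (cell `pub-gaugeboot`, page 1 of every file): the venture produces certified bounds
on lattice expectations at stated coupling, gauge group, dimension and torus size; NOT a mass gap,
NOT a continuum limit, NOT a string tension; NOT Yang–Mills-summit-bearing (barriers
`FixedCouplingUltralocality`, `PerturbativeInvisibility`). STRONG COUPLING ONLY: the cell's `SU(2)`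
certificates sit at `β_std ≥ 1/2`, where nothing is claimed. (Normalisations of record, FANOUT-PLAN
A97 (1): the `β_W` of this file IS the cell's `β_std`; the tree's bare coupling is `β_W/2 = 2·(β_W/4)`;
the 't Hooft coupling of `ClassBStrongCoupling.lean` is `β_W/4`.)

`ClassBStrongCoupling.lean` proves Class B (`ThermodynamicLimitIsClassB`) wherever the Wilson–DLR
state is unique, and instantiates it with the Shen–Zhu–Zhu window `|β| < 1/(16(d-1))` ('t Hooft
coupling). For `SU(2)` on `ℤ⁴` the tree holds a sharper hypothesis-free uniqueness window in
Wilson normalisation, `su2_dlrMassGap_var`: `0 ≤ β_W`, `81 β_W² + 6 β_W < 2` (so every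
`β_W ≤ 0.124`; tree bare coupling `2·(β_W/4) = β_W/2`), by Dobrushin's criterion with the one-link
Kantorovich modulus. This file records the corresponding Class-B statements.

References: H. Shen, R. Zhu, X. Zhu, Comm. Math. Phys. 400 (2023), remark after Thm. 1.3;
H. Föllmer, Lect. Notes Math. 1362 (1988), Ch. I Thm. (2.13); V. Kazakov, Z. Zheng,
arXiv:2203.11360 §2 (loop equations), §3.1 (the three reflection positivities).
-/

noncomputable section

open MeasureTheory
open Literature.MathematicalPhysics.QuantumLattice
open Literature.MathematicalPhysics.QuantumFieldTheory.Balaban1983to89.StrongCouplingVarianceWindow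
  (su2_dlrMassGap_var)

namespace Summit.QuantumFields.GaugeBoot

/-- **Class B for `SU(2)` on `ℤ⁴` up to Wilson coupling `β_W = 0.124`.** For `0 ≤ β_W` with
`81 β_W² + 6 β_W < 2` (tree bare coupling `2·(β_W/4) = β_W/2`, fundamental representation) every
infinite-volume limit point of the torus Wilson states of four-dimensional `SU(2)` lattice Yang–Mills
theory is a Class-B state — DLR uniqueness in this window is the tree's hypothesis-free
`su2_dlrMassGap_var`. Strong coupling only. -/
theorem thermodynamicLimitIsClassB_SU2_d4_wilsonWindow {βW : ℝ} (h0 : 0 ≤ βW)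
    (hwin : 81 * βW ^ 2 + 6 * βW < 2) :
    ThermodynamicLimitIsClassB 4 (fundamentalRep (Fin 2)) (2 * (βW / 4)) := by
  haveI : SecondCountableTopology (Matrix (Fin 2) (Fin 2) ℂ) :=
    inferInstanceAs (SecondCountableTopology (Fin 2 → Fin 2 → ℂ))
  haveI : SecondCountableTopology (Matrix.specialUnitaryGroup (Fin 2) ℂ) :=
    Topology.IsEmbedding.subtypeVal.secondCountableTopology
  exact thermodynamicLimitIsClassB_of_subsingleton (fundamentalRep (Fin 2))
    (continuous_fundamentalRep (Fin 2)) (by positivity) (su2_dlrMassGap_var h0 hwin).1.1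

/-- **The unique `SU(2)` DLR state on `ℤ⁴` at Wilson coupling `0 ≤ β_W ≤ 0.124` is a Class-B
state** (a Class-B state whose measure is THE DLR state). -/
theorem exists_classBState_SU2_d4_wilsonWindow {βW : ℝ} (h0 : 0 ≤ βW)
    (hwin : 81 * βW ^ 2 + 6 * βW < 2) :
    ∃ ω : ClassBState 4 (fundamentalRep (Fin 2)) (2 * (βW / 4)),
      ω.μ ∈ ymGibbsMeasures (d := 4) (fundamentalRep (Fin 2)) (2 * (βW / 4)) ∧
        ∀ ν ∈ ymGibbsMeasures (d := 4) (fundamentalRep (Fin 2)) (2 * (βW / 4)), ν = ω.μ := by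
  haveI : SecondCountableTopology (Matrix (Fin 2) (Fin 2) ℂ) :=
    inferInstanceAs (SecondCountableTopology (Fin 2 → Fin 2 → ℂ))
  haveI : SecondCountableTopology (Matrix.specialUnitaryGroup (Fin 2) ℂ) :=
    Topology.IsEmbedding.subtypeVal.secondCountableTopology
  exact exists_classBState_of_subsingleton (fundamentalRep (Fin 2)) (continuous_fundamentalRep (Fin 2))
    (by positivity) (su2_dlrMassGap_var h0 hwin).1.1

/-- Numerical instance: `β_W = 0.124 = 31/250` lies in the window
(`81·0.124² + 6·0.124 = 1.989456 < 2`), so Class B holds for four-dimensional `SU(2)` at every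
Wilson coupling `0 ≤ β_W ≤ 0.124`. -/
theorem thermodynamicLimitIsClassB_SU2_d4_of_le {βW : ℝ} (h0 : 0 ≤ βW) (hle : βW ≤ 31 / 250) :
    ThermodynamicLimitIsClassB 4 (fundamentalRep (Fin 2)) (2 * (βW / 4)) :=
  thermodynamicLimitIsClassB_SU2_d4_wilsonWindow h0 (by nlinarith)

end Summit.QuantumFields.GaugeBoot
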